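import Literature.Probability.Percolation.AnchoredIsoperimetricProfile
import Literature.Probability.Percolation.ConstrainedClusters
import Literature.Probability.Percolation.SiteConnectionTools
import Literature.Probability.Percolation.HalfSpace
import HarnessLib

/-!
# Vanishing of the anchored isoperimetric profile at `p_c`: proof of Cerf–Dembin 2020, Theorem 1.2,
# from the Barsky–Grimmett–Newman theorem

Topic `Literature/Probability/Percolation`. Proofs for the named fact
`Literature.Probability.Percolation.CerfDembin2020_thm12` of `AnchoredIsoperimetricProfile.lean`
(R. Cerf, B. Dembin, *Vanishing of the anchored isoperimetric profile in bond percolation at `p_c`*,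
Electron. Commun. Probab. 25 (2020), arXiv:1903.08065, Theorem 1.2: "With probability one, we have
`liminf_{n→∞} n φ̂_n(p_c) = 0`"), in the tree's `ε`–`N` form. Main results:

* `CerfDembin2020_thm12_of_theta_halfSpace` — Theorem 1.2 in a fixed dimension `d ≥ 1`, PROVED
  from the single input `θ_ℍ(p_c(ℤ^d)) = 0` (no percolation in the half-space `ℍ = {x | 0 ≤ x₀}`
  at the critical point of `ℤ^d`);
* `CerfDembin2020_thm12_of_BGN : BarskyGrimmettNewman1991 → CerfDembin2020_thm12` — Theorem 1.2
  in all dimensions `d ≥ 2` from the Barsky–Grimmett–Newman theorem as vendored in `HalfSpace.lean`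
  (Grimmett 1999, Thm. (7.35); in the tree PROVED for `d = 2`, `BarskyGrimmettNewman1991_dim_two`,
  and `d = 3`, `BarskyGrimmettNewman1991_Z3_holds`; the discharge `CerfDembin2020_thm12_holds` is
  `CerfDembin2020_thm12_of_BGN BarskyGrimmettNewman1991_holds` once the latter lands).

## The printed proof (Cerf–Dembin §2) and this formalisation

Cerf–Dembin argue by contradiction: on the event `{inf_{k ≥ n₀} k φ̂_k(p_c) > c}` (of probability
`≥ δ/2`) the exploration `𝒞_l` of `C(0)` grows like `|𝒞_{(n-n₀)k}| ≥ α n^d` (induction (ire), using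
`|𝒞_{l+1}| ≥ |𝒞_l| + |∂°𝒞_l|/(2d)` and the isoperimetric inequality `|∂°H| ≥ (c/n)|H|` for the
valid subgraphs `H = 𝒞_l`, `|H| ≤ n^d`); the exploration resumed inside `[-n,n]^d` ends with a
valid subgraph whose open edge boundary, of size `≥ (c/n)|𝒞_n| ≥ const · n^{d-1}`, exits through
the faces of the box, so some face carries `≥ const · n^{d-1}` sites joined to `0` inside the box
(the variable `X_n`); but `E X_n ≤ (2n+1)^{d-1} η` for large `n` by lattice symmetry and the
absence of percolation in half-spaces at `p_c` (Barsky–Grimmett–Newman, with Grimmett–Marstrand's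
`p_c(ℍ) = p_c`), and Markov's inequality contradicts `δ/2`.

We formalise the same argument in a direct almost-sure form (namespace `CerfDembinVanishing`):

1. `ballCluster l ω` = `𝒞_l`, realised as the intrinsic ball of radius `l` of the open
   nearest-neighbour cluster of `0` (the `l`-th step of the exploration); it is a valid subgraph,
   lies in `Λ(l)`, and `|∂° B_l| ≤ 2d(|B_{l+1}| - |B_l|)` (`openEdgeBoundaryCard_ballCluster_le`,
   the printed (iter)).
2. `badSet d c N` = `{∀ n ≥ N, ∀ valid H, |H| ≤ n^d → c|H| < n|∂°H|}` (the complement of the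
   conclusion at scale `c` from level `N`); on it, `N^d |B_{(n-N)k}| ≥ n^d` for `n ≥ N`
   (`pow_le_card_ballCluster`, the printed induction (ire) with `α = N^{-d}`,
   `k ≥ 2^{d+1}d/c`).
3. `boxCluster n ω` = the cluster of `0` inside `Λ(n)` (the terminal state of the restricted
   exploration), a valid subgraph containing `B_n`; its open edge boundary leaves the box, so
   `|∂° ·| ≤ 2d · W_n`, `W_n = |boxCluster ∩ ∂ⁱⁿΛ(n)|` (we count sites of the inner vertex boundary
   rather than face by face); on the bad set, `W_n > a n^{d-1}` for `n ≥ 2kN`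
   (`lt_card_boxCluster_inter_innerBoundary`).
4. `halfSpaceReach d n` = `{0 ↔ a site of height ≥ n, inside ℍ}`; `P_p(halfSpaceReach n) → θ_ℍ(p)`-
   bound: `→ 0` when `θ_ℍ(p) = 0` (`tendsto_measure_halfSpaceReach`, continuity from above and
   `theta_induce_eq_real_percolatesVia`); by the lattice automorphism `y ↦ σ(y - x)`,
   `P_p(x ∈ boxCluster n) ≤ P_p(halfSpaceReach n)` for `x ∈ ∂ⁱⁿΛ(n)` (`measure_mem_boxCluster_le`,
   `bondPercolation_map_relabel_iso`), whence `E_p W_n ≤ |∂ⁱⁿΛ(n)| P_p(halfSpaceReach n)`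
   (`lintegral_boundaryCount_le`, the printed (eq1)).
5. Markov: `P_p(badSet c N) ≤ K · P_p(halfSpaceReach n) → 0` (`measure_badSet_eq_zero`), and the
   conclusion for all `c > 0` follows from the scales `c = 1/(m+1)` (`ae_exists_validSubgraph`).

The deep input enters only in step 4, as the hypothesis `θ_ℍ(p) = 0` at the parameter `p`.

## References

* R. Cerf, B. Dembin, *Vanishing of the anchored isoperimetric profile in bond percolation at
  `p_c`*, Electron. Commun. Probab. 25 (2020), arXiv:1903.08065: Thm. 1.2 and §2 (proof).
* D. J. Barsky, G. R. Grimmett, C. M. Newman, *Percolation in half-spaces: equality of critical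
  densities and continuity of the percolation probability*, PTRF 90 (1991) 111–148; G. Grimmett,
  *Percolation*, 2nd ed. (1999), Thm. (7.35) (the tree's `BarskyGrimmettNewman1991`).
-/

noncomputable section

namespace Literature.Probability.Percolation

open _root_.MeasureTheory _root_.Filter LatticeModels
open scoped _root_.ENNReal _root_.Topology

namespace CerfDembinVanishing

variable {d : ℕ}

/-! ## Walks of the open lattice graph -/

/-- The graph of OPEN NEAREST-NEIGHBOUR edges of `ℤ^d` in the configuration `ω` (open pairs of `ω`
that are lattice edges). [folklore] -/
abbrev openLattice (ω : BondConfig (Site d)) : SimpleGraph (Site d) := openGraph ω ⊓ zdGraph d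

/-- A nearest-neighbour walk of length `ℓ` moves every coordinate by at most `ℓ`. [folklore] -/
theorem abs_sub_le_length {K : SimpleGraph (Site d)} (hK : K ≤ zdGraph d) {u v : Site d}
    (w : K.Walk u v) (i : Fin d) : |v i - u i| ≤ w.length := by
  induction w with
  | nil => simp
  | @cons a b c hab p ih =>
    have hstep : |b i - a i| ≤ 1 := by
      obtain ⟨j, h | h⟩ := (zdGraph_adj_iff a b).1 (hK hab)
      · rw [h]
        rcases eq_or_ne i j with rfl | hij
        · simp
        · simp [Pi.single_eq_of_ne hij]
      · rw [h]
        rcases eq_or_ne i j with rfl | hij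
        · simp
        · simp [Pi.single_eq_of_ne hij]
    rw [SimpleGraph.Walk.length_cons, Nat.cast_add, Nat.cast_one]
    calc |c i - a i| = |(c i - b i) + (b i - a i)| := by ring_nf
      _ ≤ |c i - b i| + |b i - a i| := abs_add_le _ _
      _ ≤ p.length + 1 := add_le_add ih hstep

/-- Hence a nearest-neighbour walk of length `≤ l` started at the origin ends in the box `Λ(l)`.
[folklore] -/
theorem mem_box_of_walk {K : SimpleGraph (Site d)} (hK : K ≤ zdGraph d) {v : Site d}
    (w : K.Walk 0 v) {l : ℕ} (hl : w.length ≤ l) : v ∈ box d l := by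
  rw [mem_box]
  intro i
  have h := abs_sub_le_length hK w i
  simp only [Pi.zero_apply, sub_zero] at h
  have h' : |v i| ≤ (l : ℤ) := h.trans (by exact_mod_cast hl)
  exact abs_le.1 h'

/-- A walk all of whose vertices lie in `S` is a walk "in `S`" (steps of `K ⊓ withinGraph ⊤ S`).
[folklore] -/
theorem reachable_inf_withinGraph_of_support {V : Type*} {K : SimpleGraph V} {u x : V}
    (w : K.Walk u x) {S : Set V} (h : ∀ v ∈ w.support, v ∈ S) :
    (K ⊓ withinGraph ⊤ S).Reachable u x := by
  induction w with
  | nil => rfl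
  | @cons a b c hab p ih =>
    have ha : a ∈ S := h a (by simp)
    have hb : b ∈ S := h b (by simp [p.start_mem_support])
    have hadj : (K ⊓ withinGraph ⊤ S).Adj a b := by
      simp only [SimpleGraph.inf_adj, withinGraph_adj, SimpleGraph.top_adj]
      exact ⟨hab, hab.ne, ha, hb⟩
    exact hadj.reachable.trans (ih fun v hv => h v (by simp [hv]))

/-- Bridge to the tree's `openConnIn`: a walk of the open graph (possibly with further step
constraints, `K ≤ openGraph ω`) all of whose vertices lie in the finite set `H` witnesses
`{u ↔ x in H}`. [folklore] -/
theorem mem_openConnIn_of_walk {ω : BondConfig (Site d)} {K : SimpleGraph (Site d)}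
    (hK : K ≤ openGraph ω) {u x : Site d} (w : K.Walk u x) {H : Set (Site d)}
    (h : ∀ v ∈ w.support, v ∈ H) : ω ∈ openConnIn H u x := by
  have hu : u ∈ H := h u w.start_mem_support
  rw [openConnIn_eq_openConnVia hu]
  change x ∈ openClusterIn (withinGraph ⊤ H) ω u
  rw [mem_openClusterIn_iff]
  exact (reachable_inf_withinGraph_of_support w h).mono (inf_le_inf_right _ hK)

/-! ## A counting lemma for open edge boundaries -/

/-- If every open boundary edge of `H` has an endpoint in the finite set `T`, then
`|∂_{C(0)} H| ≤ 2d |T|` (every site of `ℤ^d` has `2d` incident edges). [folklore] -/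
theorem openEdgeBoundaryCard_le_of_cover {ω : BondConfig (Site d)} {H T : Finset (Site d)}
    (h : ∀ e ∈ (↑(edgeBoundary (zdGraph d) H) : Set (Sym2 (Site d))) ∩ ω, ∃ y ∈ T, y ∈ e) :
    openEdgeBoundaryCard d ω H ≤ 2 * d * T.card := by
  classical
  set S : Set (Sym2 (Site d)) := (↑(edgeBoundary (zdGraph d) H) : Set (Sym2 (Site d))) ∩ ω
    with hS
  set U : Finset (Sym2 (Site d)) := T.biUnion fun y => (zdGraph d).incidenceFinset y with hU
  have hsub : S ⊆ ↑U := by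
    intro e he
    obtain ⟨y, hy, hye⟩ := h e he
    have heG : e ∈ (zdGraph d).edgeSet := (mem_edgeBoundary_iff.1 he.1).1
    simp only [hU, Finset.coe_biUnion, Finset.mem_coe, Set.mem_iUnion,
      SimpleGraph.mem_incidenceFinset]
    exact ⟨y, hy, heG, hye⟩
  calc openEdgeBoundaryCard d ω H = S.ncard := rfl
    _ ≤ (↑U : Set (Sym2 (Site d))).ncard := Set.ncard_le_ncard hsub U.finite_toSet
    _ = U.card := Set.ncard_coe_finset U
    _ ≤ ∑ y ∈ T, ((zdGraph d).incidenceFinset y).card := Finset.card_biUnion_le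
    _ = ∑ _y ∈ T, 2 * d := by
        refine Finset.sum_congr rfl fun y _ => ?_
        rw [SimpleGraph.card_incidenceFinset_eq_degree, ← SimpleGraph.card_neighborFinset_eq_degree]
        exact card_neighborFinset_zdGraph_holds y
    _ = 2 * d * T.card := by rw [Finset.sum_const, smul_eq_mul, mul_comm]

/-- The endpoints of a boundary edge: an edge with an endpoint in `H` and an endpoint outside `H`
is `s(x, y)` with `x ∈ H`, `y ∉ H` adjacent. [folklore] -/
theorem exists_eq_mk_of_mem_edgeBoundary {H : Finset (Site d)} {e : Sym2 (Site d)}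
    (he : e ∈ edgeBoundary (zdGraph d) H) :
    ∃ x y, x ∈ H ∧ y ∉ H ∧ (zdGraph d).Adj x y ∧ e = s(x, y) := by
  rw [mem_edgeBoundary_iff] at he
  obtain ⟨heG, ⟨x, hx, hxe⟩, ⟨y, hy, hye⟩⟩ := he
  have hxy : x ≠ y := fun h => hy (h ▸ hx)
  have he' : e = s(x, y) := (Sym2.mem_and_mem_iff hxy).1 ⟨hxe, hye⟩
  subst he'
  exact ⟨x, y, hx, hy, (SimpleGraph.mem_edgeSet _).1 heG, rfl⟩

/-! ## The intrinsic balls `B_l` of the open cluster of the origin (Cerf–Dembin's exploration `𝒞_l`) -/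

open scoped Classical in
/-- The intrinsic ball `B_l(ω)`: the sites joined to `0` by an open nearest-neighbour path of
length at most `l` — the set `𝒞_l` revealed after `l` steps of the exploration process of
Cerf–Dembin (§2: `𝒞_0 = {0}`, `𝒞_{l+1} = 𝒞_l ∪ 𝒜_{l+1}`, `𝒜_{l+1}` the sites joined to `𝒞_l` by an
open edge). It lies in the box `Λ(l)`. [cite: CerfDembin2020, §2 (exploration process 𝒞_l)] -/
def ballCluster (l : ℕ) (ω : BondConfig (Site d)) : Finset (Site d) :=
  (box d l).filter fun x => ∃ w : (openLattice ω).Walk 0 x, w.length ≤ l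

/-- Membership in the intrinsic ball. [folklore] -/
theorem mem_ballCluster_iff {l : ℕ} {ω : BondConfig (Site d)} {x : Site d} :
    x ∈ ballCluster l ω ↔ ∃ w : (openLattice ω).Walk 0 x, w.length ≤ l := by
  classical
  simp only [ballCluster, Finset.mem_filter, and_iff_right_iff_imp]
  rintro ⟨w, hw⟩
  exact mem_box_of_walk inf_le_right w hw

/-- `0 ∈ B_l`. [folklore] -/
theorem zero_mem_ballCluster (l : ℕ) (ω : BondConfig (Site d)) : (0 : Site d) ∈ ballCluster l ω :=
  mem_ballCluster_iff.2 ⟨SimpleGraph.Walk.nil, by simp⟩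

/-- The balls increase: `B_l ⊆ B_{l'}` for `l ≤ l'`. [folklore] -/
theorem ballCluster_mono {l l' : ℕ} (h : l ≤ l') (ω : BondConfig (Site d)) :
    ballCluster l ω ⊆ ballCluster l' ω := fun _ hx => by
  obtain ⟨w, hw⟩ := mem_ballCluster_iff.1 hx
  exact mem_ballCluster_iff.2 ⟨w, hw.trans h⟩

/-- `B_l ⊆ Λ(l)`. [folklore] -/
theorem ballCluster_subset_box (l : ℕ) (ω : BondConfig (Site d)) : ballCluster l ω ⊆ box d l := by
  classical
  exact Finset.filter_subset _ _

/-- Every vertex of an open path of length `≤ l` from `0` lies in `B_l` (prefixes are shorter).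
[folklore] -/
theorem support_subset_ballCluster {ω : BondConfig (Site d)} {l : ℕ} {x : Site d}
    (w : (openLattice ω).Walk 0 x) (hw : w.length ≤ l) : ∀ v ∈ w.support, v ∈ ballCluster l ω := by
  classical
  intro v hv
  exact mem_ballCluster_iff.2 ⟨w.takeUntil v hv, (w.length_takeUntil_le_length hv).trans hw⟩

/-- **`B_l` is a valid subgraph of `C(0)`** ("`𝒞_{(n-n₀)k+l}` is a valid subgraph of `𝒞(0)`",
Cerf–Dembin §2). [cite: CerfDembin2020, §2] -/
theorem isValidSubgraph_ballCluster (l : ℕ) (ω : BondConfig (Site d)) :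
    IsValidSubgraph d ω (ballCluster l ω) := by
  refine ⟨zero_mem_ballCluster l ω, fun x hx => ?_⟩
  obtain ⟨w, hw⟩ := mem_ballCluster_iff.1 hx
  exact mem_openConnIn_of_walk inf_le_left w fun v hv => support_subset_ballCluster w hw v hv

/-- **The exploration inequality** `|𝒞_{l+1}| ≥ |𝒞_l| + |∂° 𝒞_l| / (2d)` (Cerf–Dembin §2, display
(iter)): every open boundary edge of `B_l` ends in `B_{l+1} ∖ B_l`, and a site has `2d` incident
edges. [cite: CerfDembin2020, §2 (inequality |𝒞_{l+1}| ≥ |𝒞_l| + |∂°𝒞_l|/2d)] -/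
theorem openEdgeBoundaryCard_ballCluster_le (l : ℕ) (ω : BondConfig (Site d)) :
    openEdgeBoundaryCard d ω (ballCluster l ω) ≤
      2 * d * ((ballCluster (l + 1) ω).card - (ballCluster l ω).card) := by
  classical
  rw [← Finset.card_sdiff_of_subset (ballCluster_mono l.le_succ ω)]
  refine openEdgeBoundaryCard_le_of_cover fun e he => ?_
  obtain ⟨he, heω⟩ := he
  obtain ⟨x, y, hx, hy, hG, rfl⟩ := exists_eq_mk_of_mem_edgeBoundary (Finset.mem_coe.1 he)
  refine ⟨y, Finset.mem_sdiff.2 ⟨?_, hy⟩, Sym2.mem_mk_right x y⟩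
  obtain ⟨w, hw⟩ := mem_ballCluster_iff.1 hx
  have hadj : (openLattice ω).Adj x y := by
    simp only [SimpleGraph.inf_adj, openGraph_adj]
    exact ⟨⟨heω, hG.ne⟩, hG⟩
  exact mem_ballCluster_iff.2 ⟨w.concat hadj, by rw [SimpleGraph.Walk.length_concat]; omega⟩

/-! ## The open cluster of the origin inside the box `Λ(n)` (Cerf–Dembin's restricted exploration `𝒞'_l`) -/

open scoped Classical in
/-- The open cluster of `0` INSIDE the box `Λ(n) = [-n,n]^d`: the sites joined to `0` by an open
nearest-neighbour path all of whose vertices lie in `Λ(n)` — the final set of the exploration of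
`C(0)` "with the constraint that we do not explore anything outside the box `[-n,n]^d`"
(Cerf–Dembin §2). [cite: CerfDembin2020, §2 (exploration 𝒞'_l inside [-n,n]^d)] -/
def boxCluster (n : ℕ) (ω : BondConfig (Site d)) : Finset (Site d) :=
  (box d n).filter fun x => x ∈ openClusterIn (withinGraph (zdGraph d) ↑(box d n)) ω 0

/-- Membership in the box cluster. [folklore] -/
theorem mem_boxCluster_iff {n : ℕ} {ω : BondConfig (Site d)} {x : Site d} :
    x ∈ boxCluster n ω ↔ x ∈ openClusterIn (withinGraph (zdGraph d) ↑(box d n)) ω 0 := by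
  classical
  simp only [boxCluster, Finset.mem_filter, and_iff_right_iff_imp]
  exact fun h => openClusterIn_withinGraph_subset (zero_mem_box d n) ω h

/-- The box cluster lies in the box. [folklore] -/
theorem boxCluster_subset_box (n : ℕ) (ω : BondConfig (Site d)) : boxCluster n ω ⊆ box d n := by
  classical
  exact Finset.filter_subset _ _

/-- `0` lies in its box cluster. [folklore] -/
theorem zero_mem_boxCluster (n : ℕ) (ω : BondConfig (Site d)) : (0 : Site d) ∈ boxCluster n ω :=
  mem_boxCluster_iff.2 (self_mem_openClusterIn _ ω 0)

/-- **The box cluster is a valid subgraph of `C(0)`.** [cite: CerfDembin2020, §2] -/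
theorem isValidSubgraph_boxCluster (n : ℕ) (ω : BondConfig (Site d)) :
    IsValidSubgraph d ω (boxCluster n ω) := by
  classical
  refine ⟨zero_mem_boxCluster n ω, fun x hx => ?_⟩
  obtain ⟨w⟩ := mem_openClusterIn_iff.1 (mem_boxCluster_iff.1 hx)
  exact mem_openConnIn_of_walk inf_le_left w fun v hv =>
    mem_boxCluster_iff.2 (mem_openClusterIn_iff.2 ⟨w.takeUntil v hv⟩)

/-- `B_n ⊆` the box cluster of `Λ(n)`: an open path of length `≤ n` from `0` stays in `Λ(n)`
("By construction the set `𝒞_n` is inside the box `[-n,n]^d`", Cerf–Dembin §2).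
[cite: CerfDembin2020, §2] -/
theorem ballCluster_subset_boxCluster (n : ℕ) (ω : BondConfig (Site d)) :
    ballCluster n ω ⊆ boxCluster n ω := by
  intro x hx
  obtain ⟨w, hw⟩ := mem_ballCluster_iff.1 hx
  refine mem_boxCluster_iff.2 (mem_openClusterIn_iff.2 ?_)
  have h := reachable_inf_withinGraph_of_support w (S := (↑(box d n) : Set (Site d)))
    fun v hv => ballCluster_subset_box n ω (support_subset_ballCluster w hw v hv)
  refine h.mono fun a b hab => ?_
  simp only [SimpleGraph.inf_adj, withinGraph_adj, SimpleGraph.top_adj] at hab ⊢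
  exact ⟨hab.1.1, hab.1.2, hab.2.2.1, hab.2.2.2⟩

/-- **The open edge boundary of the box cluster leaves the box**: every open boundary edge of the
box cluster of `Λ(n)` has its inner endpoint on `∂ⁱⁿΛ(n)`, whence
`|∂_{C(0)} 𝒞'| ≤ 2d · |𝒞' ∩ ∂ⁱⁿΛ(n)|` (Cerf–Dembin §2: the sites of `𝒞'_l` carrying its open edge
boundary "are connected to `0` by a `p_c`-open path that remains inside the box" and lie on its
faces). [cite: CerfDembin2020, §2] -/
theorem openEdgeBoundaryCard_boxCluster_le (n : ℕ) (ω : BondConfig (Site d)) :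
    openEdgeBoundaryCard d ω (boxCluster n ω) ≤
      2 * d * (boxCluster n ω ∩ innerBoundary (zdGraph d) (box d n)).card := by
  classical
  refine openEdgeBoundaryCard_le_of_cover fun e he => ?_
  obtain ⟨he, heω⟩ := he
  obtain ⟨x, y, hx, hy, hG, rfl⟩ := exists_eq_mk_of_mem_edgeBoundary (Finset.mem_coe.1 he)
  have hybox : y ∉ box d n := by
    intro hyb
    refine hy (mem_boxCluster_iff.2 (mem_openClusterIn_of_adj (mem_boxCluster_iff.1 hx) ?_ heω))
    exact ⟨hG, boxCluster_subset_box n ω hx, hyb⟩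
  exact ⟨x, Finset.mem_inter.2 ⟨hx, mem_innerBoundary_iff.2 ⟨boxCluster_subset_box n ω hx, y, hybox,
    hG⟩⟩, Sym2.mem_mk_left x y⟩

/-- The box cluster has at most `(2n+1)^d` sites. [folklore] -/
theorem card_boxCluster_le (n : ℕ) (ω : BondConfig (Site d)) :
    (boxCluster n ω).card ≤ (2 * n + 1) ^ d :=
  (Finset.card_le_card (boxCluster_subset_box n ω)).trans (card_box d n).le

/-! ## Polynomial growth of the balls under the isoperimetric hypothesis -/

/-- The event that the conclusion of Theorem 1.2 FAILS at scale `c` from level `N` on: for every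
`n ≥ N`, every valid `H` with `|H| ≤ n^d` has `c |H| < n |∂_{C(0)} H|` (i.e. `n φ̂_n > c` for all
`n ≥ N`; Cerf–Dembin §2 condition on the event `{inf_{k ≥ n₀} k φ̂_k(p_c) > c}`).
[cite: CerfDembin2020, §2 (the event inf_{k≥n₀} k φ̂_k > c)] -/
def badSet (d : ℕ) (c : ℝ) (N : ℕ) : Set (BondConfig (Site d)) :=
  {ω | ∀ n : ℕ, N ≤ n → ∀ H : Finset (Site d), IsValidSubgraph d ω H → H.card ≤ n ^ d →
    c * H.card < n * openEdgeBoundaryCard d ω H}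

/-- The bad sets decrease in `c` and increase in `N`. [folklore] -/
theorem badSet_mono {c c' : ℝ} (hc : c' ≤ c) {N N' : ℕ} (hN : N ≤ N') :
    badSet d c N ⊆ badSet d c' N' := fun _ hω n hn H hH hcard =>
  lt_of_le_of_lt (by gcongr) (hω n (hN.trans hn) H hH hcard)

/-- `(x+1)^{e+1} ≤ x^{e+1} + (2^{e+1} - 1) x^e` for real `x ≥ 1` (binomial estimate used in
Cerf–Dembin's induction, in the form `(n+1)^d ≤ n^d + 2^d n^{d-1}`). [folklore] -/
theorem add_one_pow_succ_le {x : ℝ} (hx : 1 ≤ x) (e : ℕ) :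
    (x + 1) ^ (e + 1) ≤ x ^ (e + 1) + (2 ^ (e + 1) - 1) * x ^ e := by
  induction e with
  | zero => norm_num
  | succ e ih =>
    have hx0 : 0 ≤ x := zero_le_one.trans hx
    have hxe : x ^ e ≤ x ^ (e + 1) := pow_le_pow_right₀ hx e.le_succ
    have hT : (1 : ℝ) ≤ 2 ^ (e + 1) := one_le_pow₀ (by norm_num)
    calc (x + 1) ^ (e + 1 + 1) = (x + 1) * (x + 1) ^ (e + 1) := by ring
      _ ≤ (x + 1) * (x ^ (e + 1) + (2 ^ (e + 1) - 1) * x ^ e) :=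
          mul_le_mul_of_nonneg_left ih (by linarith)
      _ = x ^ (e + 2) + 2 ^ (e + 1) * x ^ (e + 1) + (2 ^ (e + 1) - 1) * x ^ e := by ring
      _ ≤ x ^ (e + 2) + 2 ^ (e + 1) * x ^ (e + 1) + (2 ^ (e + 1) - 1) * x ^ (e + 1) := by
          have h0 : (0 : ℝ) ≤ 2 ^ (e + 1) - 1 := by linarith
          nlinarith
      _ = x ^ (e + 1 + 1) + (2 ^ (e + 1 + 1) - 1) * x ^ (e + 1) := by ring

/-- `(n+1)^d ≤ n^d + 2^d n^d / n` for `n, d ≥ 1` ("As `k ≥ 2^{d+1}d/c`, we get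
`|𝒞_{(n+1-n₀)k}| ≥ α(n^d + 2^d n^{d-1}) ≥ α(n+1)^d`", Cerf–Dembin §2). [cite: CerfDembin2020, §2] -/
theorem add_one_pow_le {n d : ℕ} (hn : 1 ≤ n) (hd : 1 ≤ d) :
    ((n : ℝ) + 1) ^ d ≤ (n : ℝ) ^ d + 2 ^ d * (n : ℝ) ^ d / n := by
  obtain ⟨e, rfl⟩ : ∃ e, d = e + 1 := ⟨d - 1, by omega⟩
  have hx : (1 : ℝ) ≤ n := by exact_mod_cast hn
  have h := add_one_pow_succ_le hx e
  have hn0 : (n : ℝ) ≠ 0 := by positivity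
  have he : (n : ℝ) ^ (e + 1) / n = (n : ℝ) ^ e := by
    rw [pow_succ, mul_div_assoc, div_self hn0, mul_one]
  rw [mul_div_assoc, he]
  have : 0 ≤ (n : ℝ) ^ e := by positivity
  nlinarith

/-- **Cerf–Dembin's growth induction** (§2, display (ire): "`∀ n ≥ n₀, |𝒞_{(n-n₀)k}| ≥ α n^d`",
`α = n₀^{-d}`, `k` the least integer `≥ 2^{d+1} d / c`): on the bad set at scale `c` from level
`N ≥ 2` on, `N^d |B_{(n-N)k}| ≥ n^d` for every `n ≥ N`. Either `|B_{(n+1-N)k}| ≥ n^d ≥ ((n+1)/N)^d`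
outright, or all the balls `B_{(n-N)k + l}`, `l ≤ k`, are valid subgraphs with fewer than `n^d`
sites, each step then adds at least `c α n^{d-1} / (2d)` sites by the isoperimetric hypothesis
and the exploration inequality, and `k` steps add `≥ 2^d α n^{d-1} ≥ α((n+1)^d - n^d)`.
[cite: CerfDembin2020, §2 (induction (ire))] -/
theorem pow_le_card_ballCluster {c : ℝ} (hc : 0 < c) {N : ℕ} (hN : 2 ≤ N) (hd : 1 ≤ d) {k : ℕ}
    (hk : (2 : ℝ) ^ (d + 1) * d ≤ c * k) {ω : BondConfig (Site d)} (hω : ω ∈ badSet d c N) :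
    ∀ n : ℕ, N ≤ n → (n : ℝ) ^ d ≤ (N : ℝ) ^ d * (ballCluster ((n - N) * k) ω).card := by
  intro n hn
  induction n, hn using Nat.le_induction with
  | base =>
    rw [Nat.sub_self, zero_mul]
    have h1 : (1 : ℝ) ≤ (ballCluster 0 ω).card := by
      exact_mod_cast Finset.card_pos.2 ⟨0, zero_mem_ballCluster 0 ω⟩
    calc (N : ℝ) ^ d = (N : ℝ) ^ d * 1 := by ring
      _ ≤ (N : ℝ) ^ d * (ballCluster 0 ω).card := by gcongr
  | succ n hNn ih =>
    set m := (n - N) * k with hm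
    have hm' : (n + 1 - N) * k = m + k := by rw [hm, Nat.sub_add_comm hNn, Nat.succ_mul]
    rw [hm']
    have hn1 : (1 : ℝ) ≤ n := by exact_mod_cast (le_trans (by omega) hNn : 1 ≤ n)
    have hn0 : (0 : ℝ) < n := by linarith
    have hNr : (2 : ℝ) ≤ N := by exact_mod_cast hN
    have hd0 : (0 : ℝ) < d := by exact_mod_cast hd
    have hNd : (0 : ℝ) < (N : ℝ) ^ d := by positivity
    -- notation for the cardinalities, as real numbers
    set C : ℕ → ℝ := fun j => ((ballCluster (m + j) ω).card : ℝ) with hC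
    have hCmono : ∀ {i j : ℕ}, i ≤ j → C i ≤ C j := fun {i j} hij => by
      simp only [hC]
      exact_mod_cast Finset.card_le_card (ballCluster_mono (by omega) ω)
    have hC0 : (n : ℝ) ^ d ≤ (N : ℝ) ^ d * C 0 := by simpa [hC] using ih
    have hcast : (((n + 1 : ℕ) : ℝ)) ^ d = ((n : ℝ) + 1) ^ d := by push_cast; ring
    rw [hcast]
    by_cases hA : (n : ℝ) ^ d ≤ C k
    · -- `|B_{(n+1-N)k}| ≥ n^d`: then `N^d |B| ≥ (N n)^d ≥ (n+1)^d`
      calc ((n : ℝ) + 1) ^ d ≤ ((N : ℝ) * n) ^ d := by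
            gcongr
            nlinarith
        _ = (N : ℝ) ^ d * (n : ℝ) ^ d := mul_pow _ _ _
        _ ≤ (N : ℝ) ^ d * C k := by gcongr
    · have hA' : C k < (n : ℝ) ^ d := not_le.1 hA
      -- the increment at each of the `k` steps
      set δ : ℝ := c / (2 * d * n) * ((n : ℝ) ^ d / (N : ℝ) ^ d) with hδ
      have hstep : ∀ j, j < k → C j + δ ≤ C (j + 1) := by
        intro j hj
        have hHcard : (ballCluster (m + j) ω).card ≤ n ^ d := by
          have h3 : C j < (n : ℝ) ^ d := lt_of_le_of_lt (hCmono hj.le) hA'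
          simp only [hC] at h3
          exact_mod_cast h3.le
        have hiso := hω n hNn (ballCluster (m + j) ω) (isValidSubgraph_ballCluster _ ω) hHcard
        have hsub : (ballCluster (m + j) ω).card ≤ (ballCluster (m + j + 1) ω).card :=
          Finset.card_le_card (ballCluster_mono (Nat.le_succ _) ω)
        have hbd : (openEdgeBoundaryCard d ω (ballCluster (m + j) ω) : ℝ) ≤
            2 * d * (C (j + 1) - C j) := by
          have h := (Nat.cast_le (α := ℝ)).2 (openEdgeBoundaryCard_ballCluster_le (m + j) ω)
          rw [Nat.cast_mul, Nat.cast_mul, Nat.cast_sub hsub] at h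
          simpa [hC, add_assoc] using h
        have hE : c * C j / n < openEdgeBoundaryCard d ω (ballCluster (m + j) ω) := by
          rw [div_lt_iff₀ hn0]
          simpa [hC, mul_comm] using hiso
        have hlow : (n : ℝ) ^ d / (N : ℝ) ^ d ≤ C j := by
          rw [div_le_iff₀ hNd]
          calc (n : ℝ) ^ d ≤ (N : ℝ) ^ d * C 0 := hC0
            _ ≤ (N : ℝ) ^ d * C j := by gcongr; exact hCmono (Nat.zero_le j)
            _ = C j * (N : ℝ) ^ d := mul_comm _ _
        calc C j + δ ≤ C j + c / (2 * d * n) * C j := by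
              rw [hδ]
              gcongr
          _ = C j + (c * C j / n) / (2 * d) := by ring
          _ ≤ C j + (openEdgeBoundaryCard d ω (ballCluster (m + j) ω) : ℝ) / (2 * d) := by
              gcongr
          _ ≤ C j + (C (j + 1) - C j) := by
              gcongr
              rw [div_le_iff₀ (by positivity)]
              linarith
          _ = C (j + 1) := by ring
      -- summing the increments
      have hsum : ∀ j, j ≤ k → C 0 + j * δ ≤ C j := by
        intro j hj
        induction j with
        | zero => simp
        | succ j ihj =>
          calc C 0 + ((j + 1 : ℕ) : ℝ) * δ = (C 0 + j * δ) + δ := by push_cast; ring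
            _ ≤ C j + δ := by gcongr; exact ihj (by omega)
            _ ≤ C (j + 1) := hstep j (by omega)
      have hk' : (2 : ℝ) ^ d ≤ c * k / (2 * d) := by
        rw [le_div_iff₀ (by positivity)]
        calc (2 : ℝ) ^ d * (2 * d) = 2 ^ (d + 1) * d := by ring
          _ ≤ c * k := hk
      calc ((n : ℝ) + 1) ^ d ≤ (n : ℝ) ^ d + 2 ^ d * (n : ℝ) ^ d / n :=
            add_one_pow_le (by exact_mod_cast (le_trans (by omega) hNn : 1 ≤ n)) hd
        _ ≤ (n : ℝ) ^ d + c * k / (2 * d) * (n : ℝ) ^ d / n := by gcongr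
        _ = (n : ℝ) ^ d + (N : ℝ) ^ d * (k * δ) := by
            rw [hδ]
            field_simp
        _ ≤ (N : ℝ) ^ d * C 0 + (N : ℝ) ^ d * (k * δ) := by gcongr
        _ = (N : ℝ) ^ d * (C 0 + k * δ) := by ring
        _ ≤ (N : ℝ) ^ d * C k := by gcongr; exact hsum k le_rfl

/-- **The deterministic core of the proof of Theorem 1.2.** On the bad set at scale `c` from
level `N ≥ 2` on, for `k ≥ 2^{d+1} d / c` and every `n ≥ 2kN`, the box cluster of `Λ(n)` meets
`∂ⁱⁿΛ(n)` in more than `a n^{d-1}` sites, `a = c / (3 · 2d · (2kN)^d)`: the box cluster contains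
`B_n ⊇ B_{(⌊n/k⌋ - N)k}`, of size `≥ (⌊n/k⌋/N)^d ≥ (n/(2kN))^d` by the growth induction; it is a
valid subgraph with `≤ (2n+1)^d` sites, so the isoperimetric hypothesis at level `2n+1` and the
exit of its open edge boundary through `∂ⁱⁿΛ(n)` give
`c |𝒞'| < (2n+1) |∂° 𝒞'| ≤ 3n · 2d · |𝒞' ∩ ∂ⁱⁿΛ(n)|` (Cerf–Dembin §2: "`|∂°𝒞'_l| ≥ (c/n)|𝒞'_l| ≥
(c/n)|𝒞_n|`", "`|𝒞_n| ≥ α ⌊n/k⌋^d`", "therefore … at least `cα n^{d-1}/(2^d k^d 2d)` vertices that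
are connected to `0` by a `p_c`-open path that remains inside the box").
[cite: CerfDembin2020, §2 (proof of Thm 1.2, displays after (ire))] -/
theorem lt_card_boxCluster_inter_innerBoundary {c : ℝ} (hc : 0 < c) {N : ℕ} (hN : 2 ≤ N)
    (hd : 1 ≤ d) {k : ℕ} (hk1 : 1 ≤ k) (hk : (2 : ℝ) ^ (d + 1) * d ≤ c * k)
    {ω : BondConfig (Site d)} (hω : ω ∈ badSet d c N) {n : ℕ} (hn : 2 * k * N ≤ n) :
    c / (3 * (2 * d) * (2 * k * N : ℝ) ^ d) * (n : ℝ) ^ d / n <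
      ((boxCluster n ω ∩ innerBoundary (zdGraph d) (box d n)).card : ℝ) := by
  -- sizes
  have hkN : k * N ≤ n := le_trans (by nlinarith) hn
  have hNn : N ≤ n := le_trans (Nat.le_mul_of_pos_left N (by omega)) hkN
  have hn1 : 1 ≤ n := le_trans (by omega) hNn
  have hn0 : (0 : ℝ) < n := by exact_mod_cast hn1
  have hd0 : (0 : ℝ) < d := by exact_mod_cast hd
  have hNd : (0 : ℝ) < (N : ℝ) ^ d := by positivity
  -- `q = ⌊n/k⌋ ≥ N` and `q ≥ n / (2k)`
  set q := n / k with hq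
  have hqN : N ≤ q := by rw [hq, Nat.le_div_iff_mul_le (by omega)]; linarith
  have hq2 : (n : ℝ) ≤ 2 * k * q := by
    have h1 : n < k * q + k := by
      have := Nat.div_add_mod n k
      have := Nat.mod_lt n (show 0 < k by omega)
      rw [hq]; nlinarith
    have h2 : 2 * k ≤ n := le_trans (by nlinarith) hn
    have h3 : n ≤ 2 * k * q := by nlinarith
    exact_mod_cast h3
  -- the box cluster is large: `(n/(2kN))^d ≤ (q/N)^d ≤ |B_{(q-N)k}| ≤ |𝒞'|`
  have hgrowth := pow_le_card_ballCluster hc hN hd hk hω q hqN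
  have hsub : ballCluster ((q - N) * k) ω ⊆ boxCluster n ω :=
    (ballCluster_mono (by
      calc (q - N) * k ≤ q * k := Nat.mul_le_mul_right k (Nat.sub_le q N)
        _ ≤ n := by rw [hq]; exact Nat.div_mul_le_self n k) ω).trans
      (ballCluster_subset_boxCluster n ω)
  set D : ℝ := ((boxCluster n ω).card : ℝ) with hD
  have hDlow : (n : ℝ) ^ d / (2 * k * N : ℝ) ^ d ≤ D := by
    rw [div_le_iff₀ (by positivity)]
    calc (n : ℝ) ^ d ≤ (2 * k * q : ℝ) ^ d := by gcongr
      _ = (2 * k : ℝ) ^ d * (q : ℝ) ^ d := by rw [mul_pow]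
      _ ≤ (2 * k : ℝ) ^ d * ((N : ℝ) ^ d * (ballCluster ((q - N) * k) ω).card) := by gcongr
      _ ≤ (2 * k : ℝ) ^ d * ((N : ℝ) ^ d * D) := by
          gcongr
          rw [hD]
          exact_mod_cast Finset.card_le_card hsub
      _ = D * (2 * k * N : ℝ) ^ d := by ring
  -- the isoperimetric hypothesis at level `2n + 1`
  have hiso := hω (2 * n + 1) (by omega) (boxCluster n ω) (isValidSubgraph_boxCluster n ω)
    (card_boxCluster_le n ω)
  have hexit := openEdgeBoundaryCard_boxCluster_le n ω
  set W : ℝ := ((boxCluster n ω ∩ innerBoundary (zdGraph d) (box d n)).card : ℝ) with hW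
  have h1 : c * D < (2 * n + 1 : ℝ) * (2 * d * W) := by
    calc c * D < ((2 * n + 1 : ℕ) : ℝ) * (openEdgeBoundaryCard d ω (boxCluster n ω) : ℝ) := hiso
      _ ≤ ((2 * n + 1 : ℕ) : ℝ) * ((2 * d *
            (boxCluster n ω ∩ innerBoundary (zdGraph d) (box d n)).card : ℕ) : ℝ) := by
          gcongr
      _ = (2 * n + 1 : ℝ) * (2 * d * W) := by push_cast; ring
  have h2 : (2 * n + 1 : ℝ) * (2 * d * W) ≤ 3 * n * (2 * d * W) := by
    have hW0 : 0 ≤ W := by positivity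
    have hn1' : (1 : ℝ) ≤ n := by exact_mod_cast hn1
    have : (2 * n + 1 : ℝ) ≤ 3 * n := by linarith
    gcongr
  -- conclusion
  calc c / (3 * (2 * d) * (2 * k * N : ℝ) ^ d) * (n : ℝ) ^ d / n
      = c * ((n : ℝ) ^ d / (2 * k * N : ℝ) ^ d) / (3 * n * (2 * d)) := by
        field_simp
    _ ≤ c * D / (3 * n * (2 * d)) := by gcongr
    _ < W := by
        rw [div_lt_iff₀ (by positivity)]
        linarith

/-! ## The half-space input: `P_p(0 ↔ height n in ℍ) → θ_ℍ(p)` -/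

/-- The event `A_n = {0 ↔ some site of height ≥ n, inside ℍ}`: the origin is joined by an open path of
the half-space `ℍ = {x | 0 ≤ x₀}` to a site `y` with `y₀ ≥ n` (Cerf–Dembin §2: "`∃ γ` a `p_c`-open
path starting from `0` in `ℕ × ℤ^{d-1}` such that `|γ| ≥ n`", in the form needed here).
[cite: CerfDembin2020, §2 (paths from 0 in ℕ × ℤ^{d-1} of length ≥ n)] -/
def halfSpaceReach (d : ℕ) [NeZero d] (n : ℕ) : Set (BondConfig (Site d)) :=
  {ω | ∃ y ∈ openClusterIn (withinGraph (zdGraph d) (halfSpace d)) ω 0, (n : ℤ) ≤ y 0}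

/-- `A_n` is measurable (a countable union of two-point connection events). [folklore] -/
theorem measurableSet_halfSpaceReach [NeZero d] (n : ℕ) : MeasurableSet (halfSpaceReach d n) := by
  have h : halfSpaceReach d n =
      ⋃ y ∈ {y : Site d | (n : ℤ) ≤ y 0}, openConnVia (withinGraph (zdGraph d) (halfSpace d)) 0 y := by
    ext ω
    simp only [halfSpaceReach, Set.mem_setOf_eq, Set.mem_iUnion, openConnVia, exists_prop]
    exact ⟨fun ⟨y, hy, hn⟩ => ⟨y, hn, hy⟩, fun ⟨y, hn, hy⟩ => ⟨y, hy, hn⟩⟩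
  rw [h]
  exact MeasurableSet.biUnion (Set.to_countable _) fun y _ => measurableSet_openConnVia _ _ _

/-- The events `A_n` decrease in `n`. [folklore] -/
theorem antitone_halfSpaceReach [NeZero d] : Antitone (halfSpaceReach d) :=
  fun _ _ hmn _ ⟨y, hy, hyn⟩ => ⟨y, hy, le_trans (by exact_mod_cast hmn) hyn⟩

/-- `⋂_n A_n ⊆ {0 ↔ ∞ in ℍ}`: a cluster containing sites of arbitrarily large height is
infinite. [folklore] -/
theorem iInter_halfSpaceReach_subset [NeZero d] :
    ⋂ n, halfSpaceReach d n ⊆ percolatesVia (withinGraph (zdGraph d) (halfSpace d)) 0 := by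
  intro ω hω
  simp only [Set.mem_iInter] at hω
  by_contra hfin
  simp only [percolatesVia, Set.mem_setOf_eq, Set.not_infinite] at hfin
  obtain ⟨M, hM⟩ := (hfin.image fun y : Site d => y 0).bddAbove
  obtain ⟨y, hy, hyn⟩ := hω (M.toNat + 1)
  have h1 : y 0 ≤ M := hM (Set.mem_image_of_mem _ hy)
  have h2 : M < ((M.toNat + 1 : ℕ) : ℤ) := by push_cast; omega
  omega

/-- **No percolation in the half-space forces `P_p(A_n) → 0`**: `θ_ℍ(p) = P_p(0 ↔ ∞ in ℍ)`
(`theta_induce_eq_real_percolatesVia`), continuity from above along the decreasing events `A_n`,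
and `⋂_n A_n ⊆ {0 ↔ ∞ in ℍ}`. This is where Cerf–Dembin use Barsky–Grimmett–Newman (with
Grimmett–Marstrand's `p_c(ℍ) = p_c`): "for `n` large enough,
`P(∃ γ a p_c-open path starting from 0 in ℕ × ℤ^{d-1} such that |γ| ≥ n) ≤ η`".
[cite: CerfDembin2020, §2 (use of [BarskyGrimmettNewman], [GrimmettMarstrand])] -/
theorem tendsto_measure_halfSpaceReach [NeZero d] (p : unitInterval)
    (hθ : theta (halfSpaceGraph d) (halfSpaceOrigin d) p = 0) :
    Tendsto (fun n => bondPercolation (zdGraph d) p (halfSpaceReach d n)) atTop (𝓝 0) := by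
  have hreal : theta (halfSpaceGraph d) (halfSpaceOrigin d) p = (bondPercolation (zdGraph d) p).real
      (percolatesVia (withinGraph (zdGraph d) (halfSpace d)) 0) :=
    theta_induce_eq_real_percolatesVia (zdGraph d) (halfSpace d) (0 : Site d) (zero_mem_halfSpace d) p
  have h0 : bondPercolation (zdGraph d) p (percolatesVia (withinGraph (zdGraph d) (halfSpace d)) 0) = 0 := by
    rw [← measureReal_eq_zero_iff (measure_ne_top _ _), ← hreal, hθ]
  have hlim := tendsto_measure_iInter_atTop (μ := bondPercolation (zdGraph d) p)
    (fun n => (measurableSet_halfSpaceReach (d := d) n).nullMeasurableSet) antitone_halfSpaceReach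
    ⟨0, measure_ne_top _ _⟩
  rwa [measure_mono_null iInter_halfSpaceReach_subset h0] at hlim

/-! ## Symmetry: a boundary site of the box joined to `0` inside the box percolates to height `n` in a half-space -/

/-- **`P_p(x ∈ 𝒞'(Λ(n))) ≤ P_p(A_n)` for `x ∈ ∂ⁱⁿΛ(n)`** (Cerf–Dembin §2, (eq1): `E(X_n) ≤
|face| · P(∃ γ …, |γ| ≥ n)`, "using the symmetry of the lattice"): if `x_i = ∓n`, the lattice
automorphism `y ↦ σ(y - x)` (`σ` the signed coordinate permutation exchanging the axes `i` and
`0`, with sign `±`) maps `x` to `0`, the box `Λ(n)` into `ℍ`, and `0` to a site of height `n`; it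
preserves `P_p` (`bondPercolation_map_relabel_iso`) and carries constrained clusters to constrained
clusters (`openClusterIn_relabel`). [cite: CerfDembin2020, §2 ((eq1), symmetry of the lattice)] -/
theorem measure_mem_boxCluster_le [NeZero d] (p : unitInterval) {n : ℕ} {x : Site d}
    (hx : x ∈ innerBoundary (zdGraph d) (box d n)) :
    bondPercolation (zdGraph d) p {ω | x ∈ boxCluster n ω} ≤
      bondPercolation (zdGraph d) p (halfSpaceReach d n) := by
  obtain ⟨i, hi⟩ := exists_eq_of_mem_innerBoundary_box hx
  -- the sign of the reflection
  obtain ⟨s, hs0, hsbox⟩ : ∃ s : ℤˣ, (s : ℤ) * (0 - x i) = n ∧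
      ∀ y ∈ box d n, 0 ≤ (s : ℤ) * (y i - x i) := by
    by_cases hxi : x i = (n : ℤ)
    · refine ⟨-1, by rw [hxi]; simp, fun y hy => ?_⟩
      have := (mem_box.1 hy i).2
      rw [hxi]; push_cast; linarith
    · have hxi' : x i = -(n : ℤ) := hi.resolve_left hxi
      refine ⟨1, by rw [hxi']; simp, fun y hy => ?_⟩
      have := (mem_box.1 hy i).1
      rw [hxi']; push_cast; linarith
  -- the automorphism `ψ y = σ (y - x)`
  set π : Equiv.Perm (Fin d) := Equiv.swap i 0 with hπ
  set ψ : zdGraph d ≃g zdGraph d := (zdShiftIso (-x)).trans (zdSignedPermIso π fun _ => s) with hψ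
  set e : Site d ≃ Site d := ψ.toEquiv with he
  have he_apply : ∀ y, e y = Site.signedPerm π (fun _ => s) (y + -x) := fun y => rfl
  have he0 : ∀ y, e y 0 = (s : ℤ) * (y i - x i) := fun y => by
    rw [he_apply, Site.signedPerm_apply, hπ, Equiv.symm_swap, Equiv.swap_apply_right]
    simp [sub_eq_add_neg]
  have hex : e x = 0 := by rw [he_apply, add_neg_cancel, Site.signedPerm_zero]
  have hadj : ∀ u v, (zdGraph d).Adj (e u) (e v) ↔ (zdGraph d).Adj u v := fun u v => ψ.map_rel_iff'
  have hK : ∀ u v, (withinGraph (zdGraph d) (e '' ↑(box d n))).Adj (e u) (e v) ↔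
      (withinGraph (zdGraph d) ↑(box d n)).Adj u v := fun u v => by
    simp only [withinGraph_adj, e.injective.mem_set_image, hadj u v]
  have himg : e '' (↑(box d n) : Set (Site d)) ⊆ halfSpace d := by
    rintro _ ⟨y, hy, rfl⟩
    change 0 ≤ e y 0
    rw [he0]
    exact hsbox y hy
  -- the inclusion of events
  have hsub : {ω | x ∈ boxCluster n ω} ⊆
      BondConfig.relabel (sym2Equiv e) ⁻¹' halfSpaceReach d n := by
    intro ω hω
    have hxω : x ∈ openClusterIn (withinGraph (zdGraph d) ↑(box d n)) ω 0 := mem_boxCluster_iff.1 hω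
    have h0 : (0 : Site d) ∈ openClusterIn (withinGraph (zdGraph d) ↑(box d n)) ω x := by
      rw [openClusterIn_eq_of_mem hxω]
      exact self_mem_openClusterIn _ ω 0
    have hrel := openClusterIn_relabel e hK ω x
    have hmem : e 0 ∈ openClusterIn (withinGraph (zdGraph d) (e '' ↑(box d n)))
        (BondConfig.relabel (sym2Equiv e) ω) 0 := by
      have h := Set.mem_image_of_mem e h0
      rwa [← hrel, hex] at h
    refine ⟨e 0, openClusterIn_mono_graph (withinGraph_mono _ himg) _ 0 hmem, ?_⟩
    rw [he0]
    exact hs0.ge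
  calc bondPercolation (zdGraph d) p {ω | x ∈ boxCluster n ω}
      ≤ bondPercolation (zdGraph d) p (BondConfig.relabel (sym2Equiv e) ⁻¹' halfSpaceReach d n) :=
        measure_mono hsub
    _ = (bondPercolation (zdGraph d) p).map (BondConfig.relabel (sym2Equiv e)) (halfSpaceReach d n) :=
        (MeasurableEquiv.map_apply _ _).symm
    _ = bondPercolation (zdGraph d) p (halfSpaceReach d n) := by
        rw [he, bondPercolation_map_relabel_iso ψ p]

/-! ## The first moment of `W_n = |𝒞'(Λ(n)) ∩ ∂ⁱⁿΛ(n)|` -/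

/-- `W_n(ω) = |𝒞'(Λ(n))(ω) ∩ ∂ⁱⁿΛ(n)|`, the number of sites of the inner boundary of the box joined
to `0` inside the box (Cerf–Dembin's `X_n`, summed over all faces), as an `ℝ≥0∞`-valued sum of
indicators. [cite: CerfDembin2020, §2 (X_n)] -/
def boundaryCount (n : ℕ) (ω : BondConfig (Site d)) : ℝ≥0∞ :=
  ∑ x ∈ innerBoundary (zdGraph d) (box d n), {ω' : BondConfig (Site d) | x ∈ boxCluster n ω'}.indicator 1 ω

/-- `{ω | x ∈ 𝒞'(Λ(n))(ω)}` is the connection event `{0 ↔ x in Λ(n)}`. [folklore] -/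
theorem setOf_mem_boxCluster_eq (n : ℕ) (x : Site d) :
    {ω : BondConfig (Site d) | x ∈ boxCluster n ω} =
      openConnVia (withinGraph (zdGraph d) ↑(box d n)) 0 x := by
  ext ω
  exact mem_boxCluster_iff

/-- `W_n` is measurable. [folklore] -/
theorem measurable_boundaryCount (n : ℕ) : Measurable (boundaryCount (d := d) n) := by
  refine Finset.measurable_sum _ fun x _ => (measurable_one.indicator ?_)
  rw [setOf_mem_boxCluster_eq]
  exact measurableSet_openConnVia _ _ _

/-- `W_n(ω)` is the cardinality `|𝒞'(Λ(n))(ω) ∩ ∂ⁱⁿΛ(n)|`. [folklore] -/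
theorem boundaryCount_eq_card (n : ℕ) (ω : BondConfig (Site d)) :
    boundaryCount n ω = ((boxCluster n ω ∩ innerBoundary (zdGraph d) (box d n)).card : ℝ≥0∞) := by
  classical
  have h : ∀ x, ({ω' : BondConfig (Site d) | x ∈ boxCluster n ω'}.indicator (1 : BondConfig (Site d) → ℝ≥0∞) ω)
      = if x ∈ boxCluster n ω then 1 else 0 := fun x => by
    simp only [Set.indicator_apply, Set.mem_setOf_eq, Pi.one_apply]
  simp only [boundaryCount, h, Finset.sum_boole, Finset.filter_mem_eq_inter, Finset.inter_comm]

/-- **`E_p(W_n) ≤ |∂ⁱⁿΛ(n)| · P_p(A_n)`** (Cerf–Dembin §2, (eq1)). [cite: CerfDembin2020, §2 (eq1)] -/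
theorem lintegral_boundaryCount_le [NeZero d] (p : unitInterval) (n : ℕ) :
    ∫⁻ ω, boundaryCount n ω ∂(bondPercolation (zdGraph d) p) ≤
      (innerBoundary (zdGraph d) (box d n)).card * bondPercolation (zdGraph d) p (halfSpaceReach d n) := by
  have hmeas : ∀ x, MeasurableSet {ω : BondConfig (Site d) | x ∈ boxCluster n ω} := fun x => by
    rw [setOf_mem_boxCluster_eq]; exact measurableSet_openConnVia _ _ _
  unfold boundaryCount
  rw [lintegral_finsetSum _ fun x _ => measurable_one.indicator (hmeas x)]
  calc ∑ x ∈ innerBoundary (zdGraph d) (box d n),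
        ∫⁻ ω, {ω' : BondConfig (Site d) | x ∈ boxCluster n ω'}.indicator 1 ω ∂(bondPercolation (zdGraph d) p)
      = ∑ x ∈ innerBoundary (zdGraph d) (box d n),
          bondPercolation (zdGraph d) p {ω' | x ∈ boxCluster n ω'} :=
        Finset.sum_congr rfl fun x _ => lintegral_indicator_one (hmeas x)
    _ ≤ ∑ _x ∈ innerBoundary (zdGraph d) (box d n), bondPercolation (zdGraph d) p (halfSpaceReach d n) :=
        Finset.sum_le_sum fun x hx => measure_mem_boxCluster_le p hx
    _ = (innerBoundary (zdGraph d) (box d n)).card * bondPercolation (zdGraph d) p (halfSpaceReach d n) := by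
        rw [Finset.sum_const, nsmul_eq_mul]

/-! ## Assembly: the bad sets are null, and Theorem 1.2 -/

/-- **The bad sets are `P_p`-null when `θ_ℍ(p) = 0`.** For `n ≥ 2kN` the bad set lies in
`{W_n ≥ ⌈a n^{d-1}⌉}` (deterministic core), Markov's inequality and the first-moment bound give
`P_p(bad) ≤ K · P_p(A_n)` with `K = ⌈2d 3^{d-1}/a⌉` (`|∂ⁱⁿΛ(n)| ≤ 2d(2n+1)^{d-1} ≤ 2d(3n)^{d-1}`),
and `P_p(A_n) → 0` (Cerf–Dembin §2, (eq1)–(eq2) and the final contradiction).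
[cite: CerfDembin2020, §2 (proof of Thm 1.2, (eq1)–(eq2))] -/
theorem measure_badSet_eq_zero [NeZero d] (hd : 1 ≤ d) (p : unitInterval)
    (hθ : theta (halfSpaceGraph d) (halfSpaceOrigin d) p = 0) {c : ℝ} (hc : 0 < c) (N : ℕ) :
    bondPercolation (zdGraph d) p (badSet d c N) = 0 := by
  -- reduce to `N ≥ 2`
  suffices h : ∀ N, 2 ≤ N → bondPercolation (zdGraph d) p (badSet d c N) = 0 by
    exact measure_mono_null (badSet_mono le_rfl (le_max_left N 2)) (h _ (le_max_right N 2))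
  intro N hN
  obtain ⟨e, rfl⟩ : ∃ e, d = e + 1 := ⟨d - 1, by omega⟩
  set μ := bondPercolation (zdGraph (e + 1)) p with hμ
  -- the constants `k`, `a`, `K`
  set k : ℕ := ⌈(2 : ℝ) ^ (e + 1 + 1) * ((e + 1 : ℕ) : ℝ) / c⌉₊ + 1 with hk
  have hk1 : 1 ≤ k := by omega
  have hkc : (2 : ℝ) ^ (e + 1 + 1) * ((e + 1 : ℕ) : ℝ) ≤ c * k := by
    have h1 := Nat.le_ceil ((2 : ℝ) ^ (e + 1 + 1) * ((e + 1 : ℕ) : ℝ) / c)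
    rw [div_le_iff₀ hc] at h1
    calc (2 : ℝ) ^ (e + 1 + 1) * ((e + 1 : ℕ) : ℝ)
        ≤ (⌈(2 : ℝ) ^ (e + 1 + 1) * ((e + 1 : ℕ) : ℝ) / c⌉₊ : ℝ) * c := h1
      _ ≤ k * c := by gcongr; rw [hk]; push_cast; linarith
      _ = c * k := mul_comm _ _
  set a : ℝ := c / (3 * (2 * ((e + 1 : ℕ) : ℝ)) * (2 * k * N : ℝ) ^ (e + 1)) with ha
  have ha0 : 0 < a := by positivity
  set K : ℕ := ⌈2 * ((e + 1 : ℕ) : ℝ) * (3 : ℝ) ^ e / a⌉₊ with hK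
  have hKa : 2 * ((e + 1 : ℕ) : ℝ) * (3 : ℝ) ^ e ≤ K * a := by
    have h1 := Nat.le_ceil (2 * ((e + 1 : ℕ) : ℝ) * (3 : ℝ) ^ e / a)
    rwa [div_le_iff₀ ha0] at h1
  -- for `n ≥ 2kN`: `μ(bad) ≤ K μ(A_n)`
  have hbound : ∀ n, 2 * k * N ≤ n → μ (badSet (e + 1) c N) ≤ (K : ℝ≥0∞) * μ (halfSpaceReach (e + 1) n) := by
    intro n hn
    have hn1 : 1 ≤ n := le_trans (by nlinarith) hn
    have hn0 : (0 : ℝ) < n := by exact_mod_cast hn1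
    have hn1' : (1 : ℝ) ≤ n := by exact_mod_cast hn1
    set T : ℕ := ⌈a * (n : ℝ) ^ (e + 1) / n⌉₊ with hT
    have hT0 : 0 < T := Nat.ceil_pos.2 (by positivity)
    have hTa : a * (n : ℝ) ^ (e + 1) / n ≤ T := Nat.le_ceil _
    -- the bad set lies in `{T ≤ W_n}`
    have hsub : badSet (e + 1) c N ⊆ {ω | (T : ℝ≥0∞) ≤ boundaryCount n ω} := by
      intro ω hω
      have hlt := lt_card_boxCluster_inter_innerBoundary hc hN hd hk1 hkc hω hn
      have hTle : T ≤ (boxCluster n ω ∩ innerBoundary (zdGraph (e + 1)) (box (e + 1) n)).card :=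
        Nat.ceil_le.2 hlt.le
      rw [Set.mem_setOf_eq, boundaryCount_eq_card]
      exact_mod_cast hTle
    -- `|∂ⁱⁿΛ(n)| ≤ K T`
    have hKT : (innerBoundary (zdGraph (e + 1)) (box (e + 1) n)).card ≤ K * T := by
      have h1 := card_innerBoundary_box_le (d := e + 1) n
      simp only [Nat.add_sub_cancel] at h1
      have hpow : (n : ℝ) ^ (e + 1) / n = (n : ℝ) ^ e := by
        rw [pow_succ, mul_div_assoc, div_self hn0.ne', mul_one]
      have h2 : (2 * (e + 1) * (2 * n + 1) ^ e : ℝ) ≤ K * T := by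
        calc (2 * (e + 1) * (2 * n + 1) ^ e : ℝ) ≤ 2 * (e + 1) * (3 * n) ^ e := by
              gcongr; linarith
          _ = (2 * ((e + 1 : ℕ) : ℝ) * (3 : ℝ) ^ e) * (n : ℝ) ^ e := by push_cast; ring
          _ ≤ (K * a) * (n : ℝ) ^ e := by gcongr
          _ = K * (a * (n : ℝ) ^ (e + 1) / n) := by rw [mul_div_assoc, hpow]; ring
          _ ≤ K * T := by gcongr
      have h3 : 2 * (e + 1) * (2 * n + 1) ^ e ≤ K * T := by exact_mod_cast h2
      exact h1.trans h3
    -- Markov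
    have hM := mul_meas_ge_le_lintegral₀ (μ := μ) (measurable_boundaryCount n).aemeasurable (T : ℝ≥0∞)
    have hT0' : (T : ℝ≥0∞) ≠ 0 := by exact_mod_cast hT0.ne'
    rw [← ENNReal.mul_le_mul_iff_right hT0' (ENNReal.natCast_ne_top T)]
    calc (T : ℝ≥0∞) * μ (badSet (e + 1) c N) ≤ (T : ℝ≥0∞) * μ {ω | (T : ℝ≥0∞) ≤ boundaryCount n ω} := by
          gcongr
      _ ≤ ∫⁻ ω, boundaryCount n ω ∂μ := hM
      _ ≤ (innerBoundary (zdGraph (e + 1)) (box (e + 1) n)).card * μ (halfSpaceReach (e + 1) n) :=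
          lintegral_boundaryCount_le p n
      _ ≤ ((K * T : ℕ) : ℝ≥0∞) * μ (halfSpaceReach (e + 1) n) := by gcongr
      _ = (T : ℝ≥0∞) * ((K : ℝ≥0∞) * μ (halfSpaceReach (e + 1) n)) := by push_cast; ring
  -- the limit
  have hlim : Tendsto (fun n => (K : ℝ≥0∞) * μ (halfSpaceReach (e + 1) n)) atTop (𝓝 ((K : ℝ≥0∞) * 0)) :=
    ENNReal.Tendsto.const_mul (tendsto_measure_halfSpaceReach p hθ) (Or.inr (ENNReal.natCast_ne_top K))
  rw [mul_zero] at hlim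
  exact le_antisymm (ge_of_tendsto hlim (eventually_atTop.2 ⟨2 * k * N, hbound⟩)) bot_le

/-- **Theorem 1.2 in dimension `d`, from `θ_ℍ(p) = 0` at the parameter `p`** (so at `p = p_c(ℤ^d)`
by Barsky–Grimmett–Newman): `P_p`-a.s., for every `c > 0` and `N` there are `n ≥ N` and a valid
`H` with `|H| ≤ n^d` and `n |∂_{C(0)} H| ≤ c |H|`. The bad sets at the countably many scales
`c = 1/(m+1)` are null. [cite: CerfDembin2020, Thm 1.2 (proof, §2)] -/
theorem ae_exists_validSubgraph [NeZero d] (hd : 1 ≤ d) (p : unitInterval)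
    (hθ : theta (halfSpaceGraph d) (halfSpaceOrigin d) p = 0) :
    ∀ᵐ ω ∂(bondPercolation (zdGraph d) p),
      ∀ c : ℝ, 0 < c → ∀ N : ℕ, ∃ n : ℕ, N ≤ n ∧ ∃ H : Finset (Site d),
        IsValidSubgraph d ω H ∧ H.card ≤ n ^ d ∧
        (n : ℝ) * (openEdgeBoundaryCard d ω H : ℝ) ≤ c * H.card := by
  have h : ∀ m N : ℕ, ∀ᵐ ω ∂(bondPercolation (zdGraph d) p), ω ∉ badSet d (1 / ((m : ℝ) + 1)) N := by
    intro m N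
    rw [ae_iff]
    simp only [not_not, Set.setOf_mem_eq]
    exact measure_badSet_eq_zero hd p hθ (by positivity) N
  have h' : ∀ᵐ ω ∂(bondPercolation (zdGraph d) p), ∀ m N : ℕ, ω ∉ badSet d (1 / ((m : ℝ) + 1)) N := by
    rw [ae_all_iff]
    intro m
    rw [ae_all_iff]
    exact h m
  filter_upwards [h'] with ω hω c hc N
  obtain ⟨m, hm⟩ := exists_nat_one_div_lt hc
  have hωm := hω m N
  simp only [badSet, Set.mem_setOf_eq, not_forall, not_lt, exists_prop] at hωm
  obtain ⟨n, hn, H, hH, hcard, hle⟩ := hωm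
  exact ⟨n, hn, H, hH, hcard, hle.trans (mul_le_mul_of_nonneg_right hm.le (by positivity))⟩

end CerfDembinVanishing

/-! ## Theorem 1.2 -/

/-- **Cerf–Dembin 2020, Theorem 1.2, in dimension `d ≥ 1`, from the half-space input at `d`**:
if `θ_ℍ(p_c(ℤ^d)) = 0` (Barsky–Grimmett–Newman; proved in the tree for `d = 2, 3`), then
`P_{p_c}`-a.s. `liminf_n n φ̂_n(p_c) = 0` in the `ε`–`N` form of `CerfDembin2020_thm12`.
[cite: CerfDembin2020, Thm 1.2] -/
theorem CerfDembin2020_thm12_of_theta_halfSpace {d : ℕ} [NeZero d] (hd : 1 ≤ d)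
    (hθ : theta (halfSpaceGraph d) (halfSpaceOrigin d) (criticalProbI d) = 0) :
    ∀ᵐ ω ∂(bondPercolation (zdGraph d) (criticalProbI d)),
      ∀ c : ℝ, 0 < c → ∀ N : ℕ, ∃ n : ℕ, N ≤ n ∧ ∃ H : Finset (Site d),
        IsValidSubgraph d ω H ∧ H.card ≤ n ^ d ∧
        (n : ℝ) * (openEdgeBoundaryCard d ω H : ℝ) ≤ c * H.card :=
  CerfDembinVanishing.ae_exists_validSubgraph hd _ hθ

/-- **Cerf–Dembin 2020, Theorem 1.2, from the Barsky–Grimmett–Newman theorem** `θ_ℍ(p_c) = 0`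
(`BarskyGrimmettNewman1991`, `HalfSpace.lean`; Grimmett 1999, Thm. (7.35)) — the only input of
the printed proof beyond elementary counting ("In [BarskyGrimmettNewman], Barsky, Grimmett and
Newman proved that there is no percolation in a half-space at criticality", §2).
[cite: CerfDembin2020, Thm 1.2] -/
theorem CerfDembin2020_thm12_of_BGN (h : BarskyGrimmettNewman1991) : CerfDembin2020_thm12 := by
  intro d hd
  haveI : NeZero d := ⟨by omega⟩
  exact CerfDembin2020_thm12_of_theta_halfSpace (by omega) (h d hd)

end Literature.Probability.Percolation

end
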